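import Mathlib

/-!
# `ReductionRigidity` (stmt-KontsevichZagierPeriods-3407), line `Sketch`, growth line
# `bloch-suslin-rational-dilog`: the REAL five-term transfer, I — the cyclic-order algebra

Route `KontsevichZagierPeriods/HermiteRigidity`, crux `ReductionRigidity` (stmt-3407, summit-equivalent; skeleton
`Cruxes/ReductionRigidity/Lines/Sketch.lean` v7). Registered sub-goal stub `stub_neumannAlgebra` (lead c6), the
algebraic half of the lead stub `stub_neumannTransfer`. Setting: an abelian group `A`, a subgroup `H`, a symbol
`D : ℚ → A` (think `D z = [□², z/(1 − z p₀p₁)]`, value `Li₂(z)`, `z < 1`) and its normalisation `β` to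
`ℚ ∖ {0,1}` (`β z = D z` for `z < 1`, `β z = −D z⁻¹` for `z > 1`). HYPOTHESES: at RATIONAL points of `(0,1)`,
Abel's five-term identity (`hA`, shape of the landed `stub_boxFiveTerm`), Euler pairs `D t + D (1−t) ∈ H` (`hE`),
Landen pairs `D u + D (u/(u−1)) ∈ H` (`hL`). CONCLUSION: for EVERY `x ≠ y` in `ℚ ∖ {0,1}` (all twelve cyclic
configurations of `{∞,0,1,x,y} ⊂ ℝP¹`) Neumann's relator `β x − β y + β (y/x) − β ((1−x⁻¹)/(1−y⁻¹)) + β ((1−x)/(1−y))`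
lies in `H`: `β` induces an additive map on Neumann's presentation `PreBloch ℚ` into `A ⧸ H`. Mechanism:
inversion and reflection on all of `ℚ ∖ {0,1}` (`neumann_inv`, `neumann_refl`) from `hE`, `hL`; invariance of the
relator under the diagonal 3-cycle `z ↦ 1/(1−z)` (`neumann_shift`), transitive on the arcs `(−∞,0), (0,1), (1,∞)`;
four base cases with `x ∈ (0,1)` (`neumann_base_i…iv`), each ONE Abel instance + ONE Euler pair after normalising
arguments `> 1` (definition of `β`) and `< 0` (Landen). Part II (`…NeumannTransfer.lean`) feeds the hypotheses
from landed KZ move chains. References: [cite: Neumann1998, eq. (2.3)]; [cite: Zagier2007Dilogarithm, Ch. I §2];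
[cite: Suslin1991, §1]. No definitions are introduced.
-/

namespace Summit.KontsevichZagierPeriods.HermiteRigidity.ReductionRigidity

section Algebra

variable {A : Type*} [AddCommGroup A]

/-- Neumann's fourth argument in lowest terms: `(1 − x⁻¹)/(1 − y⁻¹) = y(1 − x)/(x(1 − y))`. [folklore] -/
theorem neumann_quotInv_eq {x y : ℚ} (hx : x ≠ 0) (hy : y ≠ 0) (hy1 : y ≠ 1) :
    (1 - x⁻¹) / (1 - y⁻¹) = y * (1 - x) / (x * (1 - y)) := by
  have h1y : (1 : ℚ) - y ≠ 0 := sub_ne_zero.2 (Ne.symm hy1)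
  field_simp
  ring

/-- `0 < a/b < 1` from `0 < a < b`. [folklore] -/
theorem neumann_div_mem {a b : ℚ} (ha : 0 < a) (hab : a < b) : 0 < a / b ∧ a / b < 1 :=
  ⟨div_pos ha (ha.trans hab), (div_lt_one (ha.trans hab)).2 hab⟩

/-- `0 < a/b < 1` from `b < a < 0`. [folklore] -/
theorem neumann_div_mem_neg {a b : ℚ} (ha : a < 0) (hba : b < a) : 0 < a / b ∧ a / b < 1 :=
  ⟨div_pos_of_neg_of_neg ha (hba.trans ha), (div_lt_one_of_neg (hba.trans ha)).2 hba⟩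

/-! The data `H, D, β` and the three functional equations modulo `H` (polynomial side conditions). -/
variable (H : AddSubgroup A) (D β : ℚ → A)
  (hβ₁ : ∀ z : ℚ, z < 1 → β z = D z) (hβ₂ : ∀ z : ℚ, 1 < z → β z = -D z⁻¹)
  (hA : ∀ a b c d e : ℚ, 0 < a → a < 1 → 0 < b → b < 1 → c = a * b →
    d * (1 - a * b) = a * (1 - b) → e * (1 - a * b) = b * (1 - a) → D a + D b - D c - D d - D e ∈ H)
  (hE : ∀ t t' : ℚ, 0 < t → t < 1 → t' = 1 - t → D t + D t' ∈ H)
  (hL : ∀ u u' : ℚ, 0 < u → u < 1 → u' * (u - 1) = u → D u + D u' ∈ H)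

include hβ₁ hβ₂ hE hL in
/-- **Inversion** `β z + β z⁻¹ ∈ H` for the normalised symbol `β` (`β z = D z` for `z < 1`,
`β z = −D z⁻¹` for `z > 1`), from Euler and Landen on `(0,1)`. [cite: Zagier2007Dilogarithm, Ch. I §2] -/
theorem neumann_inv
    {z z' : ℚ} (hz0 : z ≠ 0) (hz1 : z ≠ 1) (hz' : z' = z⁻¹) : β z + β z' ∈ H := by
  subst hz'
  rcases lt_trichotomy z 0 with hz | hz | hz
  · -- `z < 0`: `D z ≡ −D u`, `D z⁻¹ ≡ −D (1 − u)` with `u = z/(z−1)`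
    have hz1' : z - 1 < 0 := by linarith
    have hu : 0 < z / (z - 1) ∧ z / (z - 1) < 1 := by
      refine ⟨div_pos_of_neg_of_neg hz hz1', ?_⟩
      rw [div_lt_one_of_neg hz1']; linarith
    have hL1 := hL (z / (z - 1)) z hu.1 hu.2 (by field_simp; ring)
    have hv : 0 < 1 / (1 - z) ∧ 1 / (1 - z) < 1 :=
      ⟨one_div_pos.2 (by linarith), (div_lt_one (by linarith)).2 (by linarith)⟩
    have hL2 := hL (1 / (1 - z)) z⁻¹ hv.1 hv.2 (by
      have : (1 : ℚ) - z ≠ 0 := by linarith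
      field_simp
      ring)
    have hE1 := hE (z / (z - 1)) (1 / (1 - z)) hu.1 hu.2 (by
      have : z - 1 ≠ 0 := hz1'.ne
      have : (1 : ℚ) - z ≠ 0 := by linarith
      field_simp
      ring)
    rw [hβ₁ z (by linarith), hβ₁ z⁻¹ (by linarith [inv_lt_zero.2 hz])]
    have : D z + D z⁻¹ = (D (z / (z - 1)) + D z) + (D (1 / (1 - z)) + D z⁻¹) -
        (D (z / (z - 1)) + D (1 / (1 - z))) := by abel
    rw [this]
    exact H.sub_mem (H.add_mem hL1 hL2) hE1
  · exact absurd hz hz0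
  · rcases lt_trichotomy z 1 with h1 | h1 | h1
    · rw [hβ₁ z h1, hβ₂ z⁻¹ (one_lt_inv₀ hz |>.2 h1), inv_inv, add_neg_cancel]
      exact H.zero_mem
    · exact absurd h1 hz1
    · rw [hβ₂ z h1, hβ₁ z⁻¹ (inv_lt_one_of_one_lt₀ h1), neg_add_cancel]
      exact H.zero_mem

include hβ₁ hβ₂ hE hL in
/-- **Reflection** `β z + β (1 − z) ∈ H` for the normalised symbol, from Euler and Landen on
`(0,1)`. [cite: Zagier2007Dilogarithm, Ch. I §2] -/
theorem neumann_refl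
    {z z' : ℚ} (hz0 : z ≠ 0) (hz1 : z ≠ 1) (hz' : z' = 1 - z) : β z + β z' ∈ H := by
  subst hz'
  rcases lt_trichotomy z 0 with hz | hz | hz
  · -- `z < 0 < 1 < 1 − z`
    have hz1' : z - 1 < 0 := by linarith
    have hu : 0 < z / (z - 1) ∧ z / (z - 1) < 1 := by
      refine ⟨div_pos_of_neg_of_neg hz hz1', ?_⟩
      rw [div_lt_one_of_neg hz1']; linarith
    have hL1 := hL (z / (z - 1)) z hu.1 hu.2 (by field_simp; ring)
    have hE1 := hE (z / (z - 1)) (1 - z)⁻¹ hu.1 hu.2 (by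
      have : z - 1 ≠ 0 := hz1'.ne
      have : 1 - z ≠ 0 := by linarith
      field_simp
      ring)
    rw [hβ₁ z (by linarith), hβ₂ (1 - z) (by linarith)]
    have : D z + -D (1 - z)⁻¹ = (D (z / (z - 1)) + D z) - (D (z / (z - 1)) + D (1 - z)⁻¹) := by
      abel
    rw [this]
    exact H.sub_mem hL1 hE1
  · exact absurd hz hz0
  · rcases lt_trichotomy z 1 with h1 | h1 | h1
    · rw [hβ₁ z h1, hβ₁ (1 - z) (by linarith)]
      exact hE z (1 - z) hz h1 rfl
    · exact absurd h1 hz1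
    · -- `1 − z < 0`: `β (1 − z) = D (1 − z) ≡ −D (1 − z⁻¹)`, `β z = −D z⁻¹`
      have hzi : 0 < z⁻¹ ∧ z⁻¹ < 1 := ⟨inv_pos.2 hz, inv_lt_one_of_one_lt₀ h1⟩
      have hL1 := hL (1 - z⁻¹) (1 - z) (by linarith [hzi.2]) (by linarith [hzi.1]) (by
        have : z ≠ 0 := hz.ne'
        have : 1 - z ≠ 0 := by linarith
        field_simp
        ring)
      have hE1 := hE z⁻¹ (1 - z⁻¹) hzi.1 hzi.2 rfl
      rw [hβ₂ z h1, hβ₁ (1 - z) (by linarith)]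
      have : -D z⁻¹ + D (1 - z) = (D (1 - z⁻¹) + D (1 - z)) - (D z⁻¹ + D (1 - z⁻¹)) := by abel
      rw [this]
      exact H.sub_mem hL1 hE1

include hβ₁ hβ₂ hE hL in
/-- **Invariance of Neumann's combination under the diagonal 3-cycle `z ↦ 1/(1 − z)`** (it permutes the
five cross-ratios of `{∞,0,1,x,y}` up to inversion), from inversion and reflection. [cite: Neumann1998, eq. (2.3)] -/
theorem neumann_shift
    {x y : ℚ} (hx0 : x ≠ 0) (hx1 : x ≠ 1) (hy0 : y ≠ 0) (hy1 : y ≠ 1) (hxy : x ≠ y) :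
    (β (1 / (1 - x)) - β (1 / (1 - y)) + β ((1 / (1 - y)) / (1 / (1 - x))) -
        β ((1 - (1 / (1 - x))⁻¹) / (1 - (1 / (1 - y))⁻¹)) +
        β ((1 - 1 / (1 - x)) / (1 - 1 / (1 - y)))) -
      (β x - β y + β (y / x) - β ((1 - x⁻¹) / (1 - y⁻¹)) + β ((1 - x) / (1 - y))) ∈ H := by
  have h1x : (1 : ℚ) - x ≠ 0 := sub_ne_zero.2 (Ne.symm hx1)
  have h1y : (1 : ℚ) - y ≠ 0 := sub_ne_zero.2 (Ne.symm hy1)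
  have e1 : (1 / (1 - y)) / (1 / (1 - x)) = (1 - x) / (1 - y) := by field_simp
  have e2 : (1 - (1 / (1 - x))⁻¹) / (1 - (1 / (1 - y))⁻¹) = x / y := by
    rw [one_div, one_div, inv_inv, inv_inv]; ring
  have e3 : (1 - 1 / (1 - x)) / (1 - 1 / (1 - y)) = (1 - y⁻¹) / (1 - x⁻¹) := by
    rw [neumann_quotInv_eq hy0 hx0 hx1]
    field_simp [hy0]
    ring
  rw [e1, e2, e3]
  -- the four two-term relations
  have i1 := neumann_inv H D β hβ₁ hβ₂ hE hL (div_ne_zero hy0 hx0)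
    (fun h => hxy ((div_eq_one_iff_eq hx0).1 h).symm) (inv_div y x).symm   -- β (y/x) + β (x/y)
  have hq0 : (1 - x⁻¹) / (1 - y⁻¹) ≠ 0 := by
    rw [neumann_quotInv_eq hx0 hy0 hy1]
    refine div_ne_zero (mul_ne_zero hy0 h1x) (mul_ne_zero hx0 h1y)
  have hq1 : (1 - x⁻¹) / (1 - y⁻¹) ≠ 1 := by
    intro h
    rw [neumann_quotInv_eq hx0 hy0 hy1, div_eq_one_iff_eq (mul_ne_zero hx0 h1y)] at h
    exact hxy (by linear_combination -h)
  have i2 := neumann_inv H D β hβ₁ hβ₂ hE hL hq0 hq1 (inv_div (1 - x⁻¹) (1 - y⁻¹)).symm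
  have r1 := neumann_refl H D β hβ₁ hβ₂ hE hL hx0 hx1 rfl                 -- β x + β (1−x)
  have r2 := neumann_refl H D β hβ₁ hβ₂ hE hL hy0 hy1 rfl
  have i3 := neumann_inv H D β hβ₁ hβ₂ hE hL h1x (by
    intro h; exact hx0 (by linarith)) (one_div (1 - x))                    -- β (1−x) + β (1/(1−x))
  have i4 := neumann_inv H D β hβ₁ hβ₂ hE hL h1y (by
    intro h; exact hy0 (by linarith)) (one_div (1 - y))
  have : (β (1 / (1 - x)) - β (1 / (1 - y)) + β ((1 - x) / (1 - y)) - β (x / y) +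
        β ((1 - y⁻¹) / (1 - x⁻¹))) -
      (β x - β y + β (y / x) - β ((1 - x⁻¹) / (1 - y⁻¹)) + β ((1 - x) / (1 - y))) =
      (β (1 - x) + β (1 / (1 - x))) - (β x + β (1 - x)) - ((β (1 - y) + β (1 / (1 - y))) -
        (β y + β (1 - y))) - (β (y / x) + β (x / y)) +
        (β ((1 - x⁻¹) / (1 - y⁻¹)) + β ((1 - y⁻¹) / (1 - x⁻¹))) := by abel
  rw [this]
  exact H.add_mem (H.sub_mem (H.sub_mem (H.sub_mem i3 r1) (H.sub_mem i4 r2)) i1) i2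

include hβ₁ hA hE in
/-- Base case (i) of the cyclic order, `0 < y < x < 1` (all five arguments in `(0,1)`): Neumann's
relator is Abel's instance at `(x, y/x)` plus the Euler pair at `(1 − x)/(1 − y)`.
[cite: Neumann1998, eq. (2.3)] [cite: Zagier2007Dilogarithm, Ch. I §2] -/
theorem neumann_base_i
    {x y : ℚ} (hx1 : x < 1) (hy : 0 < y) (hyx : y < x) :
    β x - β y + β (y / x) - β ((1 - x⁻¹) / (1 - y⁻¹)) + β ((1 - x) / (1 - y)) ∈ H := by
  have hx : 0 < x := hy.trans hyx
  have hx0 : x ≠ 0 := hx.ne'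
  have hy0 : y ≠ 0 := hy.ne'
  have hy1 : y ≠ 1 := (hyx.trans hx1).ne
  have h1x : (0 : ℚ) < 1 - x := by linarith
  have h1y : (1 : ℚ) - y ≠ 0 := by linarith
  have hb := neumann_div_mem hy hyx
  have hq : (1 - x⁻¹) / (1 - y⁻¹) = y * (1 - x) / (x * (1 - y)) := neumann_quotInv_eq hx0 hy0 hy1
  have hq4 : 0 < (1 - x⁻¹) / (1 - y⁻¹) ∧ (1 - x⁻¹) / (1 - y⁻¹) < 1 := by
    rw [hq]; exact neumann_div_mem (mul_pos hy h1x) (by nlinarith)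
  have hq5 : 0 < (1 - x) / (1 - y) ∧ (1 - x) / (1 - y) < 1 := neumann_div_mem h1x (by linarith)
  have iA := hA x (y / x) y ((x - y) / (1 - y)) ((1 - x⁻¹) / (1 - y⁻¹)) hx hx1 hb.1 hb.2
    (by field_simp) (by field_simp) (by rw [hq]; field_simp)
  have iE := hE ((1 - x) / (1 - y)) ((x - y) / (1 - y)) hq5.1 hq5.2 (by field_simp; ring)
  rw [hβ₁ x hx1, hβ₁ y (hyx.trans hx1), hβ₁ _ hb.2, hβ₁ _ hq4.2, hβ₁ _ hq5.2]
  have : D x - D y + D (y / x) - D ((1 - x⁻¹) / (1 - y⁻¹)) + D ((1 - x) / (1 - y)) =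
      (D x + D (y / x) - D y - D ((x - y) / (1 - y)) - D ((1 - x⁻¹) / (1 - y⁻¹))) +
        (D ((1 - x) / (1 - y)) + D ((x - y) / (1 - y))) := by abel
  rw [this]
  exact H.add_mem iA iE

include hβ₁ hβ₂ hA hE in
/-- Base case (ii), `0 < x < y < 1` (three arguments `> 1`, inverted by definition of `β`): minus
Abel's instance at `(y, x/y)` minus the Euler pair at `(1 − y)/(1 − x)`.
[cite: Neumann1998, eq. (2.3)] [cite: Zagier2007Dilogarithm, Ch. I §2] -/
theorem neumann_base_ii
    {x y : ℚ} (hx : 0 < x) (hxy : x < y) (hy1 : y < 1) :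
    β x - β y + β (y / x) - β ((1 - x⁻¹) / (1 - y⁻¹)) + β ((1 - x) / (1 - y)) ∈ H := by
  have hy : 0 < y := hx.trans hxy
  have hx0 : x ≠ 0 := hx.ne'
  have hy0 : y ≠ 0 := hy.ne'
  have hx1 : x ≠ 1 := (hxy.trans hy1).ne
  have hy1' : y ≠ 1 := hy1.ne
  have h1y : (0 : ℚ) < 1 - y := by linarith
  have h1x : (1 : ℚ) - x ≠ 0 := by linarith
  have hb := neumann_div_mem hx hxy
  have hq : (1 - x⁻¹) / (1 - y⁻¹) = y * (1 - x) / (x * (1 - y)) := neumann_quotInv_eq hx0 hy0 hy1'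
  have hq' : (1 - y⁻¹) / (1 - x⁻¹) = x * (1 - y) / (y * (1 - x)) := neumann_quotInv_eq hy0 hx0 hx1
  have hq4 : 1 < (1 - x⁻¹) / (1 - y⁻¹) := by
    rw [hq, one_lt_div (mul_pos hx h1y)]; nlinarith
  have hq5 : 1 < (1 - x) / (1 - y) := by rw [one_lt_div h1y]; linarith
  have hyx : 1 < y / x := by rw [one_lt_div hx]; exact hxy
  have ht : 0 < (1 - y) / (1 - x) ∧ (1 - y) / (1 - x) < 1 := neumann_div_mem h1y (by linarith)
  have iA := hA y (x / y) x ((y - x) / (1 - x)) ((1 - y⁻¹) / (1 - x⁻¹)) hy hy1 hb.1 hb.2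
    (by field_simp) (by field_simp) (by rw [hq']; field_simp)
  have iE := hE ((1 - y) / (1 - x)) ((y - x) / (1 - x)) ht.1 ht.2 (by field_simp; ring)
  rw [hβ₁ x (hxy.trans hy1), hβ₁ y hy1, hβ₂ _ hyx, hβ₂ _ hq4, hβ₂ _ hq5]
  simp only [inv_div]
  have : D x - D y + -D (x / y) - -D ((1 - y⁻¹) / (1 - x⁻¹)) + -D ((1 - y) / (1 - x)) =
      -(D y + D (x / y) - D x - D ((y - x) / (1 - x)) - D ((1 - y⁻¹) / (1 - x⁻¹))) -
        (D ((1 - y) / (1 - x)) + D ((y - x) / (1 - x))) := by abel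
  rw [this]
  exact H.sub_mem (H.neg_mem iA) iE

include hβ₁ hβ₂ hA hE hL in
/-- Base case (iii), `0 < x < 1 < y` (two arguments `> 1`, two negative arguments normalised by
Landen): Abel's instance at `(x, 1/y)` plus the Euler pair at `x(y − 1)/(y − x)`.
[cite: Neumann1998, eq. (2.3)] [cite: Zagier2007Dilogarithm, Ch. I §2] -/
theorem neumann_base_iii
    {x y : ℚ} (hx : 0 < x) (hx1 : x < 1) (hy : 1 < y) :
    β x - β y + β (y / x) - β ((1 - x⁻¹) / (1 - y⁻¹)) + β ((1 - x) / (1 - y)) ∈ H := by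
  have hy0' : 0 < y := by linarith
  have hx0 : x ≠ 0 := hx.ne'
  have hy0 : y ≠ 0 := hy0'.ne'
  have hy1 : y ≠ 1 := hy.ne'
  have h1x : (0 : ℚ) < 1 - x := by linarith
  have h1y : (1 : ℚ) - y < 0 := by linarith
  have hyx0 : (0 : ℚ) < y - x := by linarith
  have hyx0' : y - x ≠ 0 := hyx0.ne'
  have h1y' : (1 : ℚ) - y ≠ 0 := h1y.ne
  have hq : (1 - x⁻¹) / (1 - y⁻¹) = y * (1 - x) / (x * (1 - y)) := neumann_quotInv_eq hx0 hy0 hy1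
  have hq4 : (1 - x⁻¹) / (1 - y⁻¹) < 0 := by
    rw [hq]; exact div_neg_of_pos_of_neg (mul_pos hy0' h1x) (mul_neg_of_pos_of_neg hx h1y)
  have hq5 : (1 - x) / (1 - y) < 0 := div_neg_of_pos_of_neg h1x h1y
  have hyx : 1 < y / x := by rw [one_lt_div hx]; linarith
  have hb : 0 < y⁻¹ ∧ y⁻¹ < 1 := ⟨inv_pos.2 hy0', inv_lt_one_of_one_lt₀ hy⟩
  have hu4 : 0 < y * (1 - x) / (y - x) ∧ y * (1 - x) / (y - x) < 1 :=
    neumann_div_mem (mul_pos hy0' h1x) (by nlinarith)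
  have hu5 : 0 < (1 - x) / (y - x) ∧ (1 - x) / (y - x) < 1 := neumann_div_mem h1x (by linarith)
  have ht : 0 < x * (y - 1) / (y - x) ∧ x * (y - 1) / (y - x) < 1 :=
    neumann_div_mem (mul_pos hx (by linarith)) (by nlinarith)
  have iL4 := hL (y * (1 - x) / (y - x)) ((1 - x⁻¹) / (1 - y⁻¹)) hu4.1 hu4.2
    (by rw [hq]; field_simp; ring)
  have iL5 := hL ((1 - x) / (y - x)) ((1 - x) / (1 - y)) hu5.1 hu5.2 (by field_simp; ring)
  have iA := hA x y⁻¹ (x / y) (x * (y - 1) / (y - x)) ((1 - x) / (y - x)) hx hx1 hb.1 hb.2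
    (div_eq_mul_inv x y) (by field_simp) (by field_simp)
  have iE := hE (x * (y - 1) / (y - x)) (y * (1 - x) / (y - x)) ht.1 ht.2 (by field_simp; ring)
  rw [hβ₁ x hx1, hβ₂ y hy, hβ₂ _ hyx, hβ₁ _ (hq4.trans zero_lt_one), hβ₁ _ (hq5.trans zero_lt_one),
    inv_div]
  have : D x - -D y⁻¹ + -D (x / y) - D ((1 - x⁻¹) / (1 - y⁻¹)) + D ((1 - x) / (1 - y)) =
      (D x + D y⁻¹ - D (x / y) - D (x * (y - 1) / (y - x)) - D ((1 - x) / (y - x))) +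
        (D (x * (y - 1) / (y - x)) + D (y * (1 - x) / (y - x))) +
        (D ((1 - x) / (y - x)) + D ((1 - x) / (1 - y))) -
        (D (y * (1 - x) / (y - x)) + D ((1 - x⁻¹) / (1 - y⁻¹))) := by abel
  rw [this]
  exact H.sub_mem (H.add_mem (H.add_mem iA iE) iL5) iL4

include hβ₁ hA hE hL in
/-- Base case (iv), `y < 0 < x < 1` (three negative arguments normalised by Landen): minus Abel's
instance at `(1 − x, y/(y − x))` plus the Euler pair at `x`.
[cite: Neumann1998, eq. (2.3)] [cite: Zagier2007Dilogarithm, Ch. I §2] -/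
theorem neumann_base_iv
    {x y : ℚ} (hx : 0 < x) (hx1 : x < 1) (hy : y < 0) :
    β x - β y + β (y / x) - β ((1 - x⁻¹) / (1 - y⁻¹)) + β ((1 - x) / (1 - y)) ∈ H := by
  have hx0 : x ≠ 0 := hx.ne'
  have hy0 : y ≠ 0 := hy.ne
  have hy1 : y ≠ 1 := by intro h; linarith
  have h1x : (0 : ℚ) < 1 - x := by linarith
  have h1y : (0 : ℚ) < 1 - y := by linarith
  have hyx0 : y - x < 0 := by linarith
  have hyx0' : y - x ≠ 0 := hyx0.ne
  have h1y' : (1 : ℚ) - y ≠ 0 := h1y.ne'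
  have hy1' : y - 1 ≠ 0 := by intro h; apply hy1; linarith
  have hq : (1 - x⁻¹) / (1 - y⁻¹) = y * (1 - x) / (x * (1 - y)) := neumann_quotInv_eq hx0 hy0 hy1
  have hq4 : (1 - x⁻¹) / (1 - y⁻¹) < 0 := by
    rw [hq]; exact div_neg_of_neg_of_pos (mul_neg_of_neg_of_pos hy h1x) (mul_pos hx h1y)
  have hq5 : 0 < (1 - x) / (1 - y) ∧ (1 - x) / (1 - y) < 1 := neumann_div_mem h1x (by linarith)
  have hyx : y / x < 0 := div_neg_of_neg_of_pos hy hx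
  have hu1 : 0 < y / (y - 1) ∧ y / (y - 1) < 1 := neumann_div_mem_neg hy (by linarith)
  have hu2 : 0 < y / (y - x) ∧ y / (y - x) < 1 := neumann_div_mem_neg hy (by linarith)
  have hu3 : 0 < y * (1 - x) / (y - x) ∧ y * (1 - x) / (y - x) < 1 :=
    neumann_div_mem_neg (mul_neg_of_neg_of_pos hy h1x) (by nlinarith)
  have iL1 := hL (y / (y - 1)) y hu1.1 hu1.2 (by field_simp; ring)
  have iL2 := hL (y / (y - x)) (y / x) hu2.1 hu2.2 (by field_simp; ring)
  have iL3 := hL (y * (1 - x) / (y - x)) ((1 - x⁻¹) / (1 - y⁻¹)) hu3.1 hu3.2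
    (by rw [hq]; field_simp; ring)
  have iA := hA (1 - x) (y / (y - x)) (y * (1 - x) / (y - x)) ((1 - x) / (1 - y)) (y / (y - 1))
    h1x (by linarith) hu2.1 hu2.2 (by ring) (by field_simp; ring) (by field_simp; ring)
  have iE := hE x (1 - x) hx hx1 rfl
  rw [hβ₁ x hx1, hβ₁ y (by linarith), hβ₁ _ (hyx.trans zero_lt_one), hβ₁ _ (hq4.trans zero_lt_one),
    hβ₁ _ hq5.2]
  have : D x - D y + D (y / x) - D ((1 - x⁻¹) / (1 - y⁻¹)) + D ((1 - x) / (1 - y)) =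
      -(D (1 - x) + D (y / (y - x)) - D (y * (1 - x) / (y - x)) - D ((1 - x) / (1 - y)) -
          D (y / (y - 1))) + (D x + D (1 - x)) - (D (y / (y - 1)) + D y) +
        (D (y / (y - x)) + D (y / x)) - (D (y * (1 - x) / (y - x)) + D ((1 - x⁻¹) / (1 - y⁻¹))) := by
    abel
  rw [this]
  exact H.sub_mem (H.add_mem (H.sub_mem (H.add_mem (H.neg_mem iA) iE) iL1) iL2) iL3

include hβ₁ hβ₂ hA hE hL in
/-- The four base cases: Neumann's relator at `(x, y)` with `0 < x < 1` lies in `H`. [cite: Neumann1998, eq. (2.3)] -/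
theorem neumann_base
    {x y : ℚ} (hx : 0 < x) (hx1 : x < 1) (hy0 : y ≠ 0) (hy1 : y ≠ 1) (hxy : x ≠ y) :
    β x - β y + β (y / x) - β ((1 - x⁻¹) / (1 - y⁻¹)) + β ((1 - x) / (1 - y)) ∈ H := by
  rcases lt_trichotomy y 0 with hy | hy | hy
  · exact neumann_base_iv H D β hβ₁ hA hE hL hx hx1 hy
  · exact absurd hy hy0
  · rcases lt_trichotomy y 1 with h1 | h1 | h1
    · rcases lt_trichotomy y x with h | h | h
      · exact neumann_base_i H D β hβ₁ hA hE hx1 hy h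
      · exact absurd h.symm hxy
      · exact neumann_base_ii H D β hβ₁ hβ₂ hA hE hx h h1
    · exact absurd h1 hy1
    · exact neumann_base_iii H D β hβ₁ hβ₂ hA hE hL hx hx1 h1

include hβ₁ hβ₂ hA hE hL in
/-- **The transfer, abstract form**: for EVERY `x ≠ y` in `ℚ ∖ {0,1}`, Neumann's relator at `(x, y)` under
the normalised symbol `β` lies in `H` — the base cases transported by the 3-cycle `z ↦ 1/(1 − z)`
(`neumann_shift`), once if `x < 0`, twice if `x > 1`. [cite: Neumann1998, eq. (2.3)] [cite: Suslin1991, §1] -/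
theorem neumann_of_hyps
    {x y : ℚ} (hx0 : x ≠ 0) (hx1 : x ≠ 1) (hy0 : y ≠ 0) (hy1 : y ≠ 1) (hxy : x ≠ y) :
    β x - β y + β (y / x) - β ((1 - x⁻¹) / (1 - y⁻¹)) + β ((1 - x) / (1 - y)) ∈ H := by
  -- the cycle `ρ z = 1/(1 − z)` keeps `ℚ ∖ {0,1}` and injectivity
  have hρ0 : ∀ z : ℚ, z ≠ 1 → 1 / (1 - z) ≠ 0 := fun z hz =>
    one_div_ne_zero (sub_ne_zero.2 (Ne.symm hz))
  have hρ1 : ∀ z : ℚ, z ≠ 0 → 1 / (1 - z) ≠ 1 := fun z hz h => by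
    have h1 : (1 : ℚ) - z ≠ 0 := fun h0 => by rw [h0, div_zero] at h; exact zero_ne_one h
    rw [div_eq_one_iff_eq h1] at h
    exact hz (by linarith)
  have hρne : ∀ z w : ℚ, z ≠ 1 → w ≠ 1 → z ≠ w → 1 / (1 - z) ≠ 1 / (1 - w) := fun z w hz hw hzw h => by
    rw [div_eq_div_iff (sub_ne_zero.2 (Ne.symm hz)) (sub_ne_zero.2 (Ne.symm hw))] at h
    exact hzw (by linarith)
  rcases lt_trichotomy x 0 with hx | hx | hx
  · -- one shift: `1/(1 − x) ∈ (0,1)`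
    have hS := neumann_shift H D β hβ₁ hβ₂ hE hL hx0 hx1 hy0 hy1 hxy
    have hB := neumann_base H D β hβ₁ hβ₂ hA hE hL (x := 1 / (1 - x)) (y := 1 / (1 - y))
      (one_div_pos.2 (by linarith)) ((div_lt_one (by linarith)).2 (by linarith)) (hρ0 y hy1)
      (hρ1 y hy0) (hρne x y hx1 hy1 hxy)
    have := H.sub_mem hB hS
    rwa [sub_sub_cancel] at this
  · exact absurd hx hx0
  · rcases lt_trichotomy x 1 with h1 | h1 | h1
    · exact neumann_base H D β hβ₁ hβ₂ hA hE hL hx h1 hy0 hy1 hxy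
    · exact absurd h1 hx1
    · -- two shifts: `1/(1 − x) < 0`, then `1/(1 − 1/(1 − x)) ∈ (0,1)`
      have hx' : 1 / (1 - x) < 0 := div_neg_of_pos_of_neg one_pos (by linarith)
      have hS := neumann_shift H D β hβ₁ hβ₂ hE hL hx0 hx1 hy0 hy1 hxy
      have hS' := neumann_shift H D β hβ₁ hβ₂ hE hL (hρ0 x hx1) (hρ1 x hx0) (hρ0 y hy1) (hρ1 y hy0)
        (hρne x y hx1 hy1 hxy)
      have hB := neumann_base H D β hβ₁ hβ₂ hA hE hL (x := 1 / (1 - 1 / (1 - x)))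
        (y := 1 / (1 - 1 / (1 - y))) (one_div_pos.2 (by linarith)) ((div_lt_one (by linarith)).2
        (by linarith)) (hρ0 _ (hρ1 y hy0)) (hρ1 _ (hρ0 y hy1))
        (hρne _ _ (hρ1 x hx0) (hρ1 y hy0) (hρne x y hx1 hy1 hxy))
      have := H.sub_mem (H.sub_mem hB hS') hS
      rwa [sub_sub_cancel, sub_sub_cancel] at this

/-- **Registered stub `stub_neumannAlgebra`** (sub-goal of crux `ReductionRigidity`, stmt-3407, line
`Sketch`, growth line `bloch-suslin-rational-dilog`): the cyclic-order algebra of the real five-term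
transfer — if a symbol `D : ℚ → A` satisfies Abel's, Euler's and Landen's relations modulo `H` at the
rational points of `(0,1)`, then its normalisation `β` kills EVERY rational Neumann five-term relator
modulo `H`. [cite: Neumann1998, eq. (2.3)] [cite: Zagier2007Dilogarithm, Ch. I §2] -/
theorem stub_neumannAlgebra : ∀ (A : Type) [AddCommGroup A] (H : AddSubgroup A) (D β : ℚ → A),
    (∀ z : ℚ, z < 1 → β z = D z) → (∀ z : ℚ, 1 < z → β z = -D z⁻¹) →
    (∀ a b c d e : ℚ, 0 < a → a < 1 → 0 < b → b < 1 → c = a * b → d * (1 - a * b) = a * (1 - b) →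
      e * (1 - a * b) = b * (1 - a) → D a + D b - D c - D d - D e ∈ H) →
    (∀ t t' : ℚ, 0 < t → t < 1 → t' = 1 - t → D t + D t' ∈ H) →
    (∀ u u' : ℚ, 0 < u → u < 1 → u' * (u - 1) = u → D u + D u' ∈ H) →
    ∀ (x y : ℚ), x ≠ 0 → x ≠ 1 → y ≠ 0 → y ≠ 1 → x ≠ y →
      β x - β y + β (y / x) - β ((1 - x⁻¹) / (1 - y⁻¹)) + β ((1 - x) / (1 - y)) ∈ H :=
  fun _ _ H D β hβ₁ hβ₂ hA hE hL _ _ hx0 hx1 hy0 hy1 hxy =>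
    neumann_of_hyps H D β hβ₁ hβ₂ hA hE hL hx0 hx1 hy0 hy1 hxy

end Algebra

end Summit.KontsevichZagierPeriods.HermiteRigidity.ReductionRigidity
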